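import Literature.NumberTheory.GelbartRogawski1991.LocalDoubledUnitaryBigCellForm
import Literature.NumberTheory.Automorphic.UnitaryGroupNonsplitPlace
import HarnessLib

-- buildfix G11b-3 recipe (LEDGER B13-1/B13-3): elaborate sequentially so the trailing `attribute [implicit_reducible]`
-- block (reducibilityCoreExt is keyed to the async environment branch) is in force at `.olean` export.
set_option Elab.async false

/-!
# The Leray cocycle of `ℓ_Δ` on the big cell of the doubled unitary group at a NON-SPLIT place: the value
# `c(ι a, ι b) = (d, det H(a,b))_v · γ⁰ⁿ` ([Kudla1994, §3, Thm 3.1]; [HarrisKudlaSweet1996, §1 (1.14)–(1.16)])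

Topic `NumberTheory/GelbartRogawski1991`; namespace
`Literature.NumberTheory.GelbartRogawski1991.UnitaryDualPair.LocalSplitting` (sequel of `LocalDoubledUnitaryBigCellForm`).
KERNEL only; no named fact, no `sorry`.

At a finite place `v` of `F` that does NOT split in `E` (`c • w = w` for the place `w ∣ v`), `E ⊗ F_v = E_w` is a field
and, for `a, b, ab` in the big cell `Ω_H` of `H(F_v) = U(𝕍 ⊕ −𝕍)(F_v)`:

* §1 `H(a, b) = (d⁻¹δ) · 2 · P(a, ab)` is hermitian (`transverseHerm_conj`) with
  `det H(a, b) = (2 d⁻¹ δ)ⁿ (−1)ⁿ · σ(det C_b · det (C_{ab}⁻¹) · det C_a) · det (T₀ ⊗ 1)` (`det_transverseHerm`), a unit;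
* §2 **`c^{ψ'}_{ℓ_Δ}(ι a, ι b) = (d, det H(a, b))_v · (γ⁰_d(ψ'))ⁿ`** (`localLeray_val_eq_hilbertSymbol_mul`;
  [HarrisKudlaSweet1996, (1.16)], tree `weilIndexSpace_resQF`, the determinant read in `F_v` through `re`).

The sequel turns the Hilbert symbol into the character values `χ_w(det C_a) χ_w(det C_b) χ_w(det C_{ab})⁻¹` of Kudla's
splitting.

## References

* S. S. Kudla, Israel J. Math. 87 (1994) 361–401, §3 and Thm 3.1 [Kudla1994].
* M. Harris, S. S. Kudla, W. J. Sweet, J. Amer. Math. Soc. 9 (1996) 941–1004, §1 (1.14)–(1.16) [HarrisKudlaSweet1996].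
-/

set_option autoImplicit false

noncomputable section

open NumberField IsDedekindDomain MeasureTheory Matrix
open Literature.RepresentationTheory.HeisenbergGroup
open Literature.NumberTheory.Automorphic Literature.NumberTheory.Automorphic.UnitaryGroup
open Literature.NumberTheory.Automorphic.UnitaryGroup.QuadraticCoordinates
open Literature.NumberTheory.GelbartRogawski1991.AdaptedBlocks
open Literature.NumberTheory.Weil1964
open Literature.NumberTheory.GaloisRepresentations.IsNonarchimedeanLocalField
open Literature.NumberTheory.QuadraticForms
open Literature.LinearAlgebra.QuadraticForm

namespace Literature.NumberTheory.GelbartRogawski1991.UnitaryDualPair.LocalSplitting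

variable (F : Type) [Field F] [NumberField F] (E : Type) [Field E] [NumberField E] [Algebra F E]
  (c : E ≃ₐ[F] E)
  {δ : E} (hcδ : c δ = -δ) (hδ : δ ≠ 0) {d : F} (hd : δ * δ = algebraMap F E d)
  (v : HeightOneSpectrum (𝓞 F)) (n : ℕ) {T₀ : Matrix (Fin n) (Fin n) F} (hT₀ : T₀.IsSymm) (hT₀d : IsUnit T₀.det)
  {JD : Matrix (Fin (n + n)) (Fin (n + n)) E} (hJD : JD = (gramD F n T₀).map (algebraMap F E))

/-! ## §1 `H(a, b)` is hermitian with unit determinant -/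

include hcδ in
/-- `σ(d⁻¹ δ · 2) = −(d⁻¹ δ · 2)`. [cite: HarrisKudlaSweet1996, §1 (1.16)] -/
theorem conj_deltaInv_two : conjLocal E c v (deltaInv F E v δ d * 2) = -(deltaInv F E v δ d * 2) := by
  rw [deltaInv, _root_.map_mul, _root_.map_mul, map_ofNat, conjLocal_toLocalRing, conjLocal_algebraMap, hcδ, map_neg, mul_neg,
    neg_mul]

/-- `T₀ ⊗ 1` is `σ`-fixed. [cite: HarrisKudlaSweet1996, §1 (1.9)] -/
theorem gramS_map_conj : (gramS F E v n T₀).map (conjLocal E c v) = gramS F E v n T₀ := by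
  ext i j
  simp only [gramS, Matrix.map_apply, conjLocal_toLocalRing]

include hT₀ in
/-- `T₀ ⊗ 1` is symmetric. [cite: HarrisKudlaSweet1996, §1 (1.9)] -/
theorem gramS_transpose : (gramS F E v n T₀)ᵀ = gramS F E v n T₀ := by
  ext i j
  simp only [gramS, Matrix.transpose_apply, Matrix.map_apply]
  rw [show T₀ j i = T₀ i j from by simpa using congrFun (congrFun hT₀ i) j]

include hcδ hδ hd in
/-- `c ⊗ 1` is an involution of `E ⊗ F_v`. [cite: HarrisKudlaSweet1996, §1 (1.11)] -/
theorem conjLocal_conjLocal' [Algebra.IsQuadraticExtension F E] (x : (LocalRing E v)) :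
    conjLocal E c v (conjLocal E c v x) = x := by
  have h := isQuadraticCoordinates_local E v c hcδ hδ hd
  conv_lhs => rw [← h.re_add_im x]
  conv_rhs => rw [← h.re_add_im x]
  simp only [map_add, _root_.map_mul, conjLocal_toLocalRing, conjLocal_algebraMap, hcδ, map_neg, neg_neg]

include hcδ hδ hd hT₀ hJD in
/-- **`H(a, b)` is hermitian**: `σ(H i j) = H j i` (`P(a, ab)` is skew-hermitian and `σ(2δ⁻¹) = −2δ⁻¹`).
[cite: Kudla1994, §3; HarrisKudlaSweet1996, §1 (1.14)] -/
theorem transverseHerm_conj [Algebra.IsQuadraticExtension F E] (a b : UnitaryGroup.localPi E c (n + n) JD v)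
    (hab : IsUnit (blkC (matA F E c v n (a * b)))) (i j : Fin n) :
    conjLocal E c v (transverseHerm F E c v n δ d T₀ a b i j) = transverseHerm F E c v n δ d T₀ a b j i := by
  have hP := cstar_transverseMatrix (σ := conjLocal E c v) (T := gramS F E v n T₀)
    (M := matA F E c v n a) (N := matA F E c v n b) (gramS_map_conj F E c v n)
    (gramS_transpose F E v n hT₀) (cstar_matA F E c v n hJD a)
    (by rw [matA_mul]; exact cstar_matA F E c v n hJD (a * b)) (conjLocal_conjLocal' F E c hcδ hδ hd v)
    (by rw [matA_mul]; exact (Matrix.isUnit_iff_isUnit_det _).1 hab)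
  have hPij : conjLocal E c v (transverseMatrix (gramS F E v n T₀) (conjLocal E c v) (matA F E c v n a)
      (matA F E c v n (a * b)) i j) =
      -transverseMatrix (gramS F E v n T₀) (conjLocal E c v) (matA F E c v n a) (matA F E c v n (a * b)) j i := by
    have := congrFun (congrFun hP j) i
    rw [matA_mul] at this
    simpa only [Matrix.transpose_apply, Matrix.map_apply, Matrix.neg_apply] using this
  rw [transverseHerm, Matrix.smul_apply, Matrix.smul_apply, smul_eq_mul, smul_eq_mul, _root_.map_mul,
    conj_deltaInv_two F E c hcδ v, hPij, neg_mul_neg]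

omit [NumberField F] in
include hcδ hδ in
/-- `c ≠ 1` (since `c δ = −δ ≠ δ`). [cite: CasselsFrohlichANT1967, Ch. VII Prop. 1.2] -/
theorem galConj_ne_one : c ≠ 1 := by
  intro h1
  apply hδ
  have h2 : (2 : E) * δ = 0 := by
    have : δ = -δ := by simpa [h1] using hcδ
    linear_combination this
  exact (mul_eq_zero.1 h2).resolve_left two_ne_zero

include hJD in
/-- **`det H(a, b) = (2 d⁻¹δ)ⁿ · (−1)ⁿ · σ(det C_b · det (C_{ab}⁻¹) · det C_a) · det(T₀ ⊗ 1)`**.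
[cite: Kudla1994, §3; HarrisKudlaSweet1996, §1 (1.15)–(1.16)] -/
theorem det_transverseHerm (a b : UnitaryGroup.localPi E c (n + n) JD v)
    (hab : IsUnit (blkC (matA F E c v n (a * b)))) :
    (transverseHerm F E c v n δ d T₀ a b).det =
      (deltaInv F E v δ d * 2) ^ n * (-1) ^ n *
        conjLocal E c v ((blkC (matA F E c v n b)).det * ((blkC (matA F E c v n (a * b)))⁻¹).det *
          (blkC (matA F E c v n a)).det) * (gramS F E v n T₀).det := by
  have hunit : IsUnit (blkC (matA F E c v n (a * b))).det := (Matrix.isUnit_iff_isUnit_det _).1 hab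
  have hP := transverseMatrix_eq (σ := conjLocal E c v) (T := gramS F E v n T₀) (M := matA F E c v n a)
    (N := matA F E c v n b) (cstar_matA F E c v n hJD a) (by rw [matA_mul]; exact hunit)
  rw [transverseHerm, Matrix.det_smul, Fintype.card_fin, ← matA_mul, hP, Matrix.det_neg, Fintype.card_fin,
    Matrix.det_mul, Matrix.det_transpose, ← RingHom.mapMatrix_apply, ← RingHom.map_det, Matrix.det_mul,
    Matrix.det_mul, matA_mul]
  ring

include hδ hd hT₀d hJD in
/-- `det H(a, b)` is a unit when `C_a`, `C_b`, `C_{ab}` are. [cite: Kudla1994, §3] -/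
theorem isUnit_det_transverseHerm [Algebra.IsQuadraticExtension F E] (a b : UnitaryGroup.localPi E c (n + n) JD v)
    (ha : IsUnit (blkC (matA F E c v n a))) (hb : IsUnit (blkC (matA F E c v n b)))
    (hab : IsUnit (blkC (matA F E c v n (a * b)))) :
    IsUnit (transverseHerm F E c v n δ d T₀ a b).det := by
  have hd0 : (d : (v.adicCompletion F)) ≠ 0 := coe_d_ne_zero F E hδ hd v
  have hδu : IsUnit (deltaInv F E v δ d) := by
    rw [deltaInv]
    exact ((IsUnit.mk0 _ (inv_ne_zero hd0)).map _).mul ((IsUnit.mk0 δ hδ).map _)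
  have h2 : IsUnit (2 : (LocalRing E v)) := isUnit_of_invertible 2
  have hT : IsUnit (gramS F E v n T₀).det := by
    rw [gramS, ← RingHom.mapMatrix_apply, ← RingHom.mapMatrix_apply, ← RingHom.map_det, ← RingHom.map_det]
    exact (hT₀d.map _).map _
  have hab' := (Matrix.isUnit_iff_isUnit_det _).1 hab
  have hσ : IsUnit (conjLocal E c v ((blkC (matA F E c v n b)).det * ((blkC (matA F E c v n (a * b)))⁻¹).det *
      (blkC (matA F E c v n a)).det)) :=
    IsUnit.map _ (((((Matrix.isUnit_iff_isUnit_det _).1 hb).mul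
      (IsUnit.of_mul_eq_one _ (Matrix.det_nonsing_inv_mul_det _ hab'))).mul ((Matrix.isUnit_iff_isUnit_det _).1 ha)))
  rw [det_transverseHerm F E c v n hJD a b hab]
  exact ((((hδu.mul h2).pow n).mul ((isUnit_one.neg).pow n)).mul hσ).mul hT

/-! ## §2 The value `(d, det H)_v γ⁰ⁿ` -/

section Value

variable [Algebra.IsQuadraticExtension F E]
  [MeasurableSpace (HeightOneSpectrum.adicCompletion F v)] [BorelSpace (HeightOneSpectrum.adicCompletion F v)]
  (μ : Measure (HeightOneSpectrum.adicCompletion F v)) [μ.IsAddHaarMeasure]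

include hT₀ in
/-- **THE LERAY COCYCLE ON THE BIG CELL AT A NON-SPLIT PLACE**:
`c^{ψ'}_{ℓ_Δ}(ι a, ι b) = (d, det H(a, b))_v · (γ⁰_d(ψ'))ⁿ` for `a, b, ab ∈ Ω_H`, `γ⁰ = γ_{ψ'}(1)γ_{ψ'}(−d)` (the determinant
read in `F_v` through `re`; `E ⊗ F_v = E_w` is a field since `v` does not split).
[cite: Kudla1994, Thm 3.1; HarrisKudlaSweet1996, §1 (1.16)] -/
theorem localLeray_val_eq_hilbertSymbol_mul {ψ' : AddChar (v.adicCompletion F) Circle} (hψ' : ψ'.IsContinuousNontrivial)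
    (w : PlacesOver E v) (hw : c • w.1 = w.1) (a b : UnitaryGroup.localPi E c (n + n) JD v)
    (ha : IsUnit (blkC (matA F E c v n a))) (hb : IsUnit (blkC (matA F E c v n b)))
    (hab : IsUnit (blkC (matA F E c v n (a * b)))) :
    ((localLeray F (n + n) (gramD F n T₀) (isUnit_det_gramD F n hT₀d) v μ ψ' hψ' (deltaLagrangian F v n)
        (deltaLagrangian_orthogonal F v n T₀ hT₀d) (iotaD F E c hcδ hδ hd v n hT₀ hJD a)
        (iotaD F E c hcδ hδ hd v n hT₀ hJD b) : ℂˣ) : ℂ) =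
      (hilbertSymbol (v.adicCompletion F) (d : (v.adicCompletion F))
          (re (quadraticLocalEquiv E v c hcδ hδ).toLinearEquiv.toAddEquiv
            (transverseHerm F E c v n δ d T₀ a b).det) : ℂ) *
        normFormIndex F v ψ' μ (d : (v.adicCompletion F)) ^ n := by
  have hF : IsField (LocalRing E v) := LocalRing.isField_of_smul_eq c (galConj_ne_one F E c hcδ hδ) w hw
  letI : Field (LocalRing E v) := hF.toField
  rw [localLeray_val_eq_weilIndex_resQF F E c hcδ hδ hd v n hT₀ hT₀d hJD μ hψ' a b ha hab]
  exact weilIndexSpace_resQF F v μ (isQuadraticCoordinates_local E v c hcδ hδ hd) (conjLocal_toLocalRing c v)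
    (by rw [conjLocal_algebraMap, hcδ, map_neg]) hψ' (coe_d_ne_zero F E hδ hd v) _
    (transverseHerm_conj F E c hcδ hδ hd v n hT₀ hJD a b hab)
    (isUnit_det_transverseHerm F E c hδ hd v n hT₀d hJD a b ha hb hab).ne_zero

end Value

/-! ### Build-lane note (ops-buildfix G11b-3 recipe, LEDGER B13-1, 2026-08-21)
`lean -o` (the hub build lane, never `lean`/the gate check) runs Lean 4.32's library-suggestion indexers
(`Lean.LibrarySuggestions.SymbolFrequency` / `SineQuaNon`, from their `exportEntriesFn`) over the statement of
every local theorem that is not a denied premise; on this family's statements (very large dependent binder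
telescopes through the theta-kernel / dual-pair data) that fold runs for tens of minutes to hours and the build
lane kills the job (incident G11b-3, run/shared/lean/ops/buildfix/G11b-3-DOSSIER.md). `isDeniedPremise` skips
`[implicit_reducible]` constants before any fold, and a reducibility status on a *theorem* is inert (Meta never
unfolds `thmInfo`; the kernel ignores the attribute), so the public theorems of this file are tagged
`[implicit_reducible]` purely to keep them out of that index. Only other effect: they are not offered by
`+suggestions` premise selectors. No statement or proof is changed; superseded if the operator lands a
deny-list form (`HarnessLib.PremiseIndex`). -/
set_option allowUnsafeReducibility true in
attribute [implicit_reducible]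
  conj_deltaInv_two gramS_map_conj gramS_transpose conjLocal_conjLocal' transverseHerm_conj
  galConj_ne_one det_transverseHerm isUnit_det_transverseHerm localLeray_val_eq_hilbertSymbol_mul

end Literature.NumberTheory.GelbartRogawski1991.UnitaryDualPair.LocalSplitting

end
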